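import Summits.AtomisticToContinuum.BoseEinsteinCondensation.Theses.BECPhononFloor
import Literature.MathematicalPhysics.QuantumManyBody.PeriodicBoseGasFracEnergy
import Literature.MathematicalPhysics.QuantumManyBody.BoseGasThermodynamicLimitRuelle

/-!
# Route BECPhononFloor, support item `FloorModeCounting` (stmt-AtomisticToContinuum-11455)

Closes `…Theses.BECPhononFloor.FloorModeCounting`: for each repulsive finite-range `v`,
[PhononFloor body for `v`] → [MesoscopicTail body for `v`] → [PeriodicBEC body for `v`], i.e.
the thin-cube-shell floor `S_Ψ(r) ≤ C·S_Ψ(s) + 1` (`1 ≤ r ≤ s ≤ R := K L√ρ/2π`) together with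
the mesoscopic tail bound `∑_{cube(M) \ cube(m)} n_Ψ ≤ εN` (`m + 1 ≥ K₀L√ρ/2π`) forces
constant-mode condensation `⟨Ψ, n₀Ψ⟩ ≥ N/4` of the same near-minimisers on the torus of side
`L = (N/ρ)^{1/3}`.

Proof (finite shell count; the item's sketch with the pairing `r ↦ r + m` in place of the
average over the reference window): take `K, C` from the floor, apply the tail with
`K₀ = K/2`, `ε = 1/(4(C+1))`, `δ = min(δ₁, δ₂)`; put `m = ⌈R/2⌉₊ - 1`, so that `R/2 ≤ m + 1`
(the tail applies from shell `m + 1` on) and `2m < R` (the floor applies to every pair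
`(r, r + m)`, `1 ≤ r ≤ m`). Then `∑_{r ≤ m} S(r) ≤ C ∑_{m < s ≤ 2m} S(s) + m ≤ CεN + m`,
everything beyond shell `m` carries `≤ εN`, and Parseval in the traced variable
(`∑_{n ∈ ℤ³} n_Ψ(n) = N`, tree: `PeriodicTrialState.tsum_cellOccupation_planeWaveMode`;
`n_Ψ(0) = ⟨Ψ, n₀Ψ⟩`, `cellOccupation_planeWaveMode_zero`) gives
`n₀ ≥ N - (C+1)εN - m = 3N/4 - m ≥ N/4` once `m ≤ R/2 ≤ N/2` (`R = K√ρL/2π ≤ ρL³ = N` for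
`L ≥ max(1, K/(2π√ρ))`, eventually in `N`).

Notation in the statements below (written out, as in the route items): the cube
`cube(r) = Finset.Icc (-r) r ⊂ ℤ³`, the thin shell `cube(r) \ Finset.Icc (-(r-1)) (r-1)`
(`= {‖n‖_∞ = r}` for `r ≥ 1`), and the sup norm `‖n‖_∞ = Finset.univ.sup (|n ·|) ∈ ℕ`.

## References

* [LSSY2005] Lieb, Seiringer, Solovej, Yngvason, *The Mathematics of the Bose Gas and its
  Condensation* (2005), §1.2 (1.17)–(1.19) (one-particle density matrix, `tr γ = N`).
* [KLS1988PRL] Kennedy, Lieb, Shastry, Phys. Rev. Lett. 61 (1988) 2582 (mode counting).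
-/

noncomputable section

open MeasureTheory Filter
open scoped ENNReal NNReal BigOperators

namespace Summit.AtomisticToContinuum.BoseEinsteinCondensation.Theorems

open Literature.MathematicalPhysics.QuantumManyBody.BoseGas

namespace FloorModeCounting

/-! ## §1 Lattice bookkeeping: cubes `{-r,…,r}³`, thin cube shells, the sup norm -/

/-- Membership in the cube of radius `r` is `‖n‖_∞ ≤ r`. [folklore] -/
theorem mem_cube {r : ℕ} {n : Fin 3 → ℤ} :
    n ∈ Finset.Icc (fun _ : Fin 3 => -(r : ℤ)) (fun _ : Fin 3 => (r : ℤ)) ↔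
      (Finset.univ.sup fun k : Fin 3 => (n k).natAbs) ≤ r := by
  simp only [Finset.mem_Icc, Pi.le_def, Finset.sup_le_iff, Finset.mem_univ, true_implies]
  constructor
  · rintro ⟨h1, h2⟩ k
    have := h1 k
    have := h2 k
    omega
  · intro h
    exact ⟨fun k => by have := h k; omega, fun k => by have := h k; omega⟩

/-- The cube of radius `0` is `{0}`. [folklore] -/
theorem cube_zero :
    Finset.Icc (fun _ : Fin 3 => -((0 : ℕ) : ℤ)) (fun _ : Fin 3 => ((0 : ℕ) : ℤ)) = {0} := by
  ext n
  simp only [Finset.mem_Icc, Pi.le_def, Finset.mem_singleton, Nat.cast_zero, neg_zero,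
    funext_iff, Pi.zero_apply]
  constructor
  · rintro ⟨h1, h2⟩ k
    exact le_antisymm (h2 k) (h1 k)
  · intro h
    exact ⟨fun k => (h k).ge, fun k => (h k).le⟩

/-- Every finite set of lattice points lies in some cube. [folklore] -/
theorem exists_subset_cube (t : Finset (Fin 3 → ℤ)) :
    ∃ M : ℕ, t ⊆ Finset.Icc (fun _ : Fin 3 => -(M : ℤ)) (fun _ : Fin 3 => (M : ℤ)) :=
  ⟨t.sup fun n => Finset.univ.sup fun k : Fin 3 => (n k).natAbs, fun _ hn =>
    mem_cube.2 (Finset.le_sup (f := fun n => Finset.univ.sup fun k : Fin 3 => (n k).natAbs) hn)⟩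

/-- Membership in the thin shell of radius `r ≥ 1` is `‖n‖_∞ = r`. [folklore] -/
theorem mem_shell {r : ℕ} (hr : 1 ≤ r) {n : Fin 3 → ℤ} :
    n ∈ Finset.Icc (fun _ : Fin 3 => -(r : ℤ)) (fun _ : Fin 3 => (r : ℤ)) \
        Finset.Icc (fun _ : Fin 3 => -((r : ℤ) - 1)) (fun _ : Fin 3 => ((r : ℤ) - 1)) ↔
      (Finset.univ.sup fun k : Fin 3 => (n k).natAbs) = r := by
  have h : ((r : ℤ) - 1) = ((r - 1 : ℕ) : ℤ) := (Nat.cast_pred hr).symm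
  rw [Finset.mem_sdiff, mem_cube]
  simp only [h]
  rw [mem_cube]
  omega

/-- **Shell decomposition of a cubic annulus**:
`∑_{cube(M) \ cube(m)} f = ∑_{m < r ≤ M} ∑_{‖n‖_∞ = r} f`. [folklore] -/
theorem sum_sdiff_cube_eq {A : Type*} [AddCommMonoid A] (f : (Fin 3 → ℤ) → A) (m M : ℕ) :
    ∑ n ∈ Finset.Icc (fun _ : Fin 3 => -(M : ℤ)) (fun _ : Fin 3 => (M : ℤ)) \
        Finset.Icc (fun _ : Fin 3 => -(m : ℤ)) (fun _ : Fin 3 => (m : ℤ)), f n =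
      ∑ r ∈ Finset.Ioc m M, ∑ n ∈ Finset.Icc (fun _ : Fin 3 => -(r : ℤ)) (fun _ : Fin 3 => (r : ℤ)) \
        Finset.Icc (fun _ : Fin 3 => -((r : ℤ) - 1)) (fun _ : Fin 3 => ((r : ℤ) - 1)), f n := by
  have hmaps : ∀ n ∈ Finset.Icc (fun _ : Fin 3 => -(M : ℤ)) (fun _ : Fin 3 => (M : ℤ)) \
      Finset.Icc (fun _ : Fin 3 => -(m : ℤ)) (fun _ : Fin 3 => (m : ℤ)),
      (Finset.univ.sup fun k : Fin 3 => (n k).natAbs) ∈ Finset.Ioc m M := by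
    intro n hn
    rw [Finset.mem_sdiff, mem_cube, mem_cube] at hn
    rw [Finset.mem_Ioc]
    omega
  rw [← Finset.sum_fiberwise_of_maps_to
    (g := fun n => Finset.univ.sup fun k : Fin 3 => (n k).natAbs) hmaps f]
  refine Finset.sum_congr rfl fun r hr => Finset.sum_congr ?_ fun _ _ => rfl
  rw [Finset.mem_Ioc] at hr
  ext n
  rw [Finset.mem_filter, Finset.mem_sdiff, mem_cube, mem_cube, mem_shell (by omega)]
  omega

/-- **Shell decomposition of a cube**: `∑_{cube(M)} f = f 0 + ∑_{0 < r ≤ M} ∑_{‖n‖_∞ = r} f`.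
[folklore] -/
theorem sum_cube_eq {A : Type*} [AddCommMonoid A] (f : (Fin 3 → ℤ) → A) (M : ℕ) :
    ∑ n ∈ Finset.Icc (fun _ : Fin 3 => -(M : ℤ)) (fun _ : Fin 3 => (M : ℤ)), f n =
      f 0 + ∑ r ∈ Finset.Ioc 0 M,
        ∑ n ∈ Finset.Icc (fun _ : Fin 3 => -(r : ℤ)) (fun _ : Fin 3 => (r : ℤ)) \
          Finset.Icc (fun _ : Fin 3 => -((r : ℤ) - 1)) (fun _ : Fin 3 => ((r : ℤ) - 1)), f n := by
  have h0 : Finset.Icc (fun _ : Fin 3 => -((0 : ℕ) : ℤ)) (fun _ : Fin 3 => ((0 : ℕ) : ℤ)) ⊆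
      Finset.Icc (fun _ : Fin 3 => -(M : ℤ)) (fun _ : Fin 3 => (M : ℤ)) := fun n hn =>
    mem_cube.2 ((mem_cube.1 hn).trans (Nat.zero_le M))
  rw [← Finset.sum_sdiff h0, sum_sdiff_cube_eq f 0 M, cube_zero, Finset.sum_singleton, add_comm]

/-- Shifting the shell index: `∑_{m < s ≤ 2m} g(s) = ∑_{0 < r ≤ m} g(r + m)`. [folklore] -/
theorem sum_Ioc_shift {A : Type*} [AddCommMonoid A] (g : ℕ → A) (m : ℕ) :
    ∑ s ∈ Finset.Ioc m (m + m), g s = ∑ r ∈ Finset.Ioc 0 m, g (r + m) := by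
  have h : Finset.Ioc m (m + m) = (Finset.Ioc 0 m).map (addRightEmbedding m) := by
    rw [Finset.map_add_right_Ioc, zero_add]
  rw [h, Finset.sum_map]
  rfl

/-! ## §2 An elementary fact on the side length -/

/-- `R = K√ρ L/(2π) ≤ ρL³` once `L ≥ 1` and `L ≥ K/(2π√ρ)`. [folklore] -/
theorem window_le_particleNumber {K ρ L : ℝ} (hρ : 0 < ρ) (hL1 : 1 ≤ L)
    (hLK : K / (2 * Real.pi * Real.sqrt ρ) ≤ L) :
    K * L * Real.sqrt ρ / (2 * Real.pi) ≤ ρ * L ^ 3 := by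
  have hsq : Real.sqrt ρ * Real.sqrt ρ = ρ := Real.mul_self_sqrt hρ.le
  have hρs : 0 < Real.sqrt ρ := Real.sqrt_pos.2 hρ
  have hL0 : 0 ≤ L := zero_le_one.trans hL1
  rw [div_le_iff₀ (by positivity)] at hLK
  rw [div_le_iff₀ (by positivity)]
  calc K * L * Real.sqrt ρ ≤ L * (2 * Real.pi * Real.sqrt ρ) * L * Real.sqrt ρ := by gcongr
    _ = 2 * Real.pi * (Real.sqrt ρ * Real.sqrt ρ) * L ^ 2 := by ring
    _ = 2 * Real.pi * ρ * L ^ 2 := by rw [hsq]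
    _ ≤ 2 * Real.pi * ρ * L ^ 3 := by
        have h23 : L ^ 2 ≤ L ^ 3 := pow_le_pow_right₀ hL1 (by norm_num)
        exact mul_le_mul_of_nonneg_left h23 (by positivity)
    _ = ρ * L ^ 3 * (2 * Real.pi) := by ring

end FloorModeCounting

/-! ## §3 The route item -/

open Summit.AtomisticToContinuum.BoseEinsteinCondensation.Theses.BECPhononFloor
open FloorModeCounting

/-- **Floor mode counting** (route BECPhononFloor, item `FloorModeCounting`,
stmt-AtomisticToContinuum-11455): for every repulsive finite-range `v`, the phonon floor on the
thin-cube-shell occupations (`S_Ψ(r) ≤ C·S_Ψ(s) + 1`, `1 ≤ r ≤ s ≤ KL√ρ/2π`) and the mesoscopic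
tail bound (`∑_{cube(M)∖cube(m)} n_Ψ ≤ εN` whenever `m + 1 ≥ K₀L√ρ/2π`, for all `K₀, ε > 0` at
small density) for the `δ`-near-minimisers of the periodic `N`-body energy on the torus of side
`L = (N/ρ)^{1/3}` imply constant-mode condensation `⟨Ψ, n₀Ψ⟩ ≥ N/4` of the same near-minimisers,
for all small `ρ`, eventually in `N` (shell count with `K₀ = K/2`, `ε = 1/(4(C+1))`,
`m = ⌈R/2⌉₊ - 1`, pairing `r ↦ r + m`, Parseval `∑ₙ n_Ψ(n) = N`).
[cite: LSSY2005, §1.2 (1.17)–(1.19)] -/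
theorem FloorModeCounting_proof : FloorModeCounting := by
  intro v _hv hPF hMT
  obtain ⟨K, hK, C, hC, ρ₁, hρ₁, hPF⟩ := hPF
  -- constants: `ε = 1/(4(C+1))`, `K₀ = K/2`
  set ε : ℝ := 1 / (4 * (C + 1)) with hε
  have hε0 : 0 < ε := by positivity
  have hCε : (C + 1) * ε = 1 / 4 := by
    rw [hε]
    field_simp
  obtain ⟨ρ₂, hρ₂, hMT⟩ := hMT (K / 2) (by positivity) ε hε0
  refine ⟨min ρ₁ ρ₂, lt_min hρ₁ hρ₂, fun ρ hρ hρlt => ⟨1 / 4, by norm_num, ?_⟩⟩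
  have hρlt₁ : ρ < ρ₁ := hρlt.trans_le (min_le_left _ _)
  have hρlt₂ : ρ < ρ₂ := hρlt.trans_le (min_le_right _ _)
  filter_upwards [hPF ρ hρ hρlt₁, hMT ρ hρ hρlt₂,
    (tendsto_sideLength_atTop hρ).eventually_ge_atTop (max 1 (K / (2 * Real.pi * Real.sqrt ρ)))]
    with N hPFN hMTN hLge
  clear hPF hMT
  -- the side `L`, the window `R = KL√ρ/2π`, the cut `m = ⌈R/2⌉₊ - 1`
  have hNL : (N : ℝ) = ρ * sideLength ρ N ^ 3 := by
    rw [sideLength_pow_three hρ N]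
    field_simp
  generalize sideLength ρ N = L at hPFN hMTN hLge hNL ⊢
  have hL1 : 1 ≤ L := (le_max_left _ _).trans hLge
  have hL : 0 < L := one_pos.trans_le hL1
  set R : ℝ := K * L * Real.sqrt ρ / (2 * Real.pi) with hR
  have hR0 : 0 ≤ R / 2 := by positivity
  have hRN : R ≤ N := by
    rw [hNL, hR]
    exact window_le_particleNumber hρ hL1 ((le_max_right _ _).trans hLge)
  set m : ℕ := ⌈R / 2⌉₊ - 1 with hm
  have hm1 : R / 2 ≤ (m : ℝ) + 1 := by
    have h1 : ⌈R / 2⌉₊ ≤ m + 1 := by rw [hm]; omega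
    calc R / 2 ≤ (⌈R / 2⌉₊ : ℝ) := Nat.le_ceil _
      _ ≤ ((m + 1 : ℕ) : ℝ) := by exact_mod_cast h1
      _ = (m : ℝ) + 1 := by push_cast; ring
  have hmR : (m : ℝ) ≤ R / 2 := by
    rcases Nat.eq_zero_or_pos ⌈R / 2⌉₊ with h0 | hpos
    · have : m = 0 := by rw [hm, h0]
      rw [this, Nat.cast_zero]
      exact hR0
    · have h1 : (m : ℝ) = (⌈R / 2⌉₊ : ℝ) - 1 := by
        rw [hm, Nat.cast_sub (by omega), Nat.cast_one]
      have h2 := Nat.ceil_lt_add_one hR0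
      linarith
  have hmN : (m : ℝ) ≤ N / 2 := by linarith
  have hrm : ∀ r : ℕ, 1 ≤ r → r ≤ m → ((r + m : ℕ) : ℝ) ≤ R := by
    intro r hr1 hrle
    have hceil : ⌈R / 2⌉₊ = m + 1 := by omega
    have h2 := Nat.ceil_lt_add_one hR0
    rw [hceil] at h2
    push_cast at h2
    have : (r : ℝ) ≤ m := by exact_mod_cast hrle
    push_cast
    linarith
  -- the slack `δ = min(δ₁, δ₂)` and a near-minimiser `Ψ`
  obtain ⟨δ₁, hδ₁, hPFN⟩ := hPFN
  obtain ⟨δ₂, hδ₂, hMTN⟩ := hMTN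
  refine ⟨min δ₁ δ₂, lt_min hδ₁ hδ₂, fun Ψ hΨ => ?_⟩
  have hPFΨ := hPFN Ψ (hΨ.trans (add_le_add le_rfl (min_le_left _ _)))
  have hMTΨ := hMTN Ψ (hΨ.trans (add_le_add le_rfl (min_le_right _ _)))
  clear hPFN hMTN
  -- the plane-wave occupations `n_Ψ(n)`, shell sums `S r`, annulus sums `T m' M`, cube sums `Q M`
  set occ : (Fin 3 → ℤ) → ℝ≥0∞ := fun n =>
    cellOccupation N L (fun x => ((Real.sqrt (L ^ 3))⁻¹ : ℂ) * cellWave L n x) Ψ.ψ with hocc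
  have hmode : ∀ n : Fin 3 → ℤ,
      (fun x => ((Real.sqrt (L ^ 3))⁻¹ : ℂ) * cellWave L n x) = planeWaveMode L n := fun n =>
    funext fun x => (planeWaveMode_eq L n x).symm
  have hoccn : ∀ n, occ n = cellOccupation N L (planeWaveMode L n) Ψ.ψ := fun n =>
    congrArg (fun φ => cellOccupation N L φ Ψ.ψ) (hmode n)
  set S : ℕ → ℝ≥0∞ := fun r =>
    ∑ n ∈ Finset.Icc (fun _ : Fin 3 => -(r : ℤ)) (fun _ : Fin 3 => (r : ℤ)) \
      Finset.Icc (fun _ : Fin 3 => -((r : ℤ) - 1)) (fun _ : Fin 3 => ((r : ℤ) - 1)), occ n with hS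
  set T : ℕ → ℕ → ℝ≥0∞ := fun m' M =>
    ∑ n ∈ Finset.Icc (fun _ : Fin 3 => -(M : ℤ)) (fun _ : Fin 3 => (M : ℤ)) \
      Finset.Icc (fun _ : Fin 3 => -(m' : ℤ)) (fun _ : Fin 3 => (m' : ℤ)), occ n with hT
  set Q : ℕ → ℝ≥0∞ := fun M =>
    ∑ n ∈ Finset.Icc (fun _ : Fin 3 => -(M : ℤ)) (fun _ : Fin 3 => (M : ℤ)), occ n with hQ
  have hTS : ∀ m' M : ℕ, T m' M = ∑ r ∈ Finset.Ioc m' M, S r := fun m' M =>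
    sum_sdiff_cube_eq occ m' M
  have hQS : ∀ M : ℕ, Q M = occ 0 + ∑ r ∈ Finset.Ioc 0 M, S r := fun M => sum_cube_eq occ M
  have hQmono : ∀ M M' : ℕ, M ≤ M' → Q M ≤ Q M' := fun M M' h =>
    Finset.sum_le_sum_of_subset fun n hn => mem_cube.2 ((mem_cube.1 hn).trans h)
  -- (tail) everything beyond shell `m` carries at most `εN`
  have hUV : ∀ M : ℕ, T m M ≤ ENNReal.ofReal (ε * N) := fun M =>
    hMTΨ m M (by
      calc K / 2 * L * Real.sqrt ρ / (2 * Real.pi) = R / 2 := by rw [hR]; ring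
        _ ≤ (m : ℝ) + 1 := hm1)
  -- (floor) the infrared shells `1 ≤ r ≤ m`, paired with the shells `m < r + m ≤ 2m < R`
  have hPF : ∀ r : ℕ, 1 ≤ r → r ≤ m → S r ≤ ENNReal.ofReal C * S (r + m) + 1 := fun r hr1 hrle =>
    hPFΨ r (r + m) hr1 (Nat.le_add_right r m) (hrm r hr1 hrle)
  have hIR : ∑ r ∈ Finset.Ioc 0 m, S r ≤ ENNReal.ofReal C * ENNReal.ofReal (ε * N) + m := by
    calc ∑ r ∈ Finset.Ioc 0 m, S r
        ≤ ∑ r ∈ Finset.Ioc 0 m, (ENNReal.ofReal C * S (r + m) + 1) :=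
          Finset.sum_le_sum fun r hr => by
            rw [Finset.mem_Ioc] at hr
            exact hPF r hr.1 hr.2
      _ = ENNReal.ofReal C * ∑ r ∈ Finset.Ioc 0 m, S (r + m) + m := by
          rw [Finset.sum_add_distrib, ← Finset.mul_sum, Finset.sum_const, Nat.card_Ioc,
            Nat.sub_zero, nsmul_eq_mul, mul_one]
      _ = ENNReal.ofReal C * T m (m + m) + m := by rw [hTS, sum_Ioc_shift]
      _ ≤ ENNReal.ofReal C * ENNReal.ofReal (ε * N) + m := by
          gcongr
          exact hUV _
  -- (count) every cube carries at most `n₀ + CεN + m + εN`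
  set B : ℝ≥0∞ := ENNReal.ofReal C * ENNReal.ofReal (ε * N) + m + ENNReal.ofReal (ε * N) with hB
  have hcube : ∀ M : ℕ, Q M ≤ occ 0 + B := by
    intro M
    calc Q M ≤ Q (M + m) := hQmono M (M + m) (Nat.le_add_right M m)
      _ = occ 0 + (∑ r ∈ Finset.Ioc 0 m, S r + ∑ r ∈ Finset.Ioc m (M + m), S r) := by
          rw [hQS, Finset.sum_Ioc_consecutive _ (Nat.zero_le m) (Nat.le_add_left m M)]
      _ = occ 0 + (∑ r ∈ Finset.Ioc 0 m, S r + T m (M + m)) := by rw [← hTS m (M + m)]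
      _ ≤ occ 0 + (ENNReal.ofReal C * ENNReal.ofReal (ε * N) + m + ENNReal.ofReal (ε * N)) :=
          add_le_add le_rfl (add_le_add hIR (hUV _))
      _ = occ 0 + B := by rw [hB]
  -- (Parseval) `N = ∑ₙ n_Ψ(n) = sup_M ∑_{cube(M)} n_Ψ(n) ≤ n₀ + B`
  have hsum : (N : ℝ≥0∞) ≤ occ 0 + B := by
    calc (N : ℝ≥0∞) = ∑' n, occ n := by
          simp only [hoccn]
          exact (Ψ.tsum_cellOccupation_planeWaveMode hL).symm
      _ = ⨆ M : ℕ, Q M := ENNReal.tsum_eq_iSup_sum' _ exists_subset_cube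
      _ ≤ occ 0 + B := iSup_le hcube
  -- (arithmetic) `N/4 + B = N/4 + (C+1)εN + m = N/2 + m ≤ N`
  have hBtop : B ≠ ⊤ := by
    rw [hB]
    exact ENNReal.add_ne_top.2 ⟨ENNReal.add_ne_top.2
      ⟨ENNReal.mul_ne_top ENNReal.ofReal_ne_top ENNReal.ofReal_ne_top, ENNReal.natCast_ne_top m⟩,
      ENNReal.ofReal_ne_top⟩
  have hkey : ENNReal.ofReal (1 / 4 * N) + B ≤ (N : ℝ≥0∞) := by
    have hBreal : B = ENNReal.ofReal (C * (ε * N) + m + ε * N) := by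
      rw [hB, ENNReal.ofReal_add (by positivity) (by positivity),
        ENNReal.ofReal_add (by positivity) (by positivity), ENNReal.ofReal_mul hC.le,
        ENNReal.ofReal_natCast]
    rw [hBreal, ← ENNReal.ofReal_add (by positivity) (by positivity), ← ENNReal.ofReal_natCast]
    refine ENNReal.ofReal_le_ofReal ?_
    have h1 : C * (ε * N) + ε * N = (N : ℝ) / 4 := by
      rw [show C * (ε * N) + ε * N = ((C + 1) * ε) * N by ring, hCε]
      ring
    linarith
  -- conclusion
  have h0 : occ 0 = condensateOccupation N L Ψ.ψ := by
    rw [hoccn 0, cellOccupation_planeWaveMode_zero]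
  rw [← h0]
  exact ENNReal.le_of_add_le_add_right hBtop (hkey.trans hsum)

end Summit.AtomisticToContinuum.BoseEinsteinCondensation.Theorems

end
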